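import Literature.RepresentationTheory.Paul1998.MetaplecticDetCoverLifting
import Literature.RepresentationTheory.KonnoKonno2007.JunctionFockVacuumCharacterPrinted
import Literature.RepresentationTheory.KonnoKonno2007.JunctionDetCharacters
import Literature.RepresentationTheory.KonnoKonno2007.JunctionDegreeOneKTypes
import HarnessLib

/-!
# The junction `U(2,1) × U(1)` of the real unitary dual pair `(U(V), U(W))`, `sgn V = (2,1)`, `sgn W = (1,0)`:
# the instance of record, HYPOTHESIS-FREE (Konno–Konno 2007 Lemma 5.2 · Folland 1989 (4.37)/(4.39) · Paul 1998 §1.2)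

Topic `RepresentationTheory/KonnoKonno2007`; namespace `Literature.RepresentationTheory.KonnoKonno2007.RealDualPair`
(+ a `Paul1998.MetaplecticSplitting` section).  KERNEL ONLY: every statement below is PROVED from landed tree
theorems; **no named fact, no `Prop`-valued definition, no hypothesis** — in particular neither the record
`RealDualPairJunction.FockVacuumCharacter(Printed)` ([KonnoKonno2007, Lemma 5.2]) nor R1/R2
(`Folland1989_Thm_4_37_ab/_c`) nor `DualPairCoverDatum.DetCoverLifting` ([Paul1998, (1.2.1)–(1.2.2)]) is assumed:
at this junction they are THEOREMS (`fockVacuumCharacter_ι₁`, `folland1989_Thm_4_37_ab_holds`,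
`detCoverLifting_ι₁`).  The file declares theorems only (no `def`).

WHY THIS FILE.  The Layer-C definitions tribunal of lane `lit-hodgefound` (TRIBUNAL-C §2 C2 «the tribunal will
demand the `k = 0`/vacuum instance and the degree-one `K`-type count (`dim = 2` for `U(2)` on `ℂ²`) as theorems»;
§1b V-C2.iv → P-C2-05; §1 row C2-06 «`coverDatum` takes `[Nonempty (P ⊕ Q)] [Nonempty (R ⊕ S)]` + `pr` — check
hypothesis-freeness at `(2,1,1,0)`»; DAG-C C2-05/C2-06) asks, for `(p,q,r,s) = (2,1,1,0)` — in the tree's currency the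
block index types `(P,Q,R,S) = (Fin 2, Unit, Unit, Empty)`, the «`ι₁`» junction of `JunctionDegreeOneKTypes` /
`JunctionDetCharacters` / `JunctionFockVacuumCharacterPrinted` (`card_blocks_ι₁`) — for:
(a) the junction instance; (b) the vacuum character EVALUATED; (c) the degree-one `K`-type count; (d) the
side conditions of Paul's det-cover datum discharged concretely.  All four are assembled here from the ≈ 40
`KonnoKonno2007/Junction*` and `Paul1998/*` files, with NOTHING left as a binder:

* (a) the instance `junction (Fin 2) Unit Unit Empty : RealDualPairJunction (Fin 2) Unit Unit Empty (U(2,1) × U(1,0))`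
  (`RealUnitaryDualPair`; `Ginf = UForm (Fin 2) Unit × UForm Unit Empty`) with its fields `ι𝕎`, `κ` and `ι𝕎 ∘ κ = realifySp ∘
  dualPairι` (`junction_ι₁_spec`) — constructed in the tree, recorded here at the `ι₁` currency.
* (b) **`fockVacuumCharacter_ι₁ : (junction (Fin 2) Unit Unit Empty).FockVacuumCharacter ⟨0, −1, 0, 0⟩`** — the record of
  [KonnoKonno2007, Lemma 5.2] HOLDS at this junction, realised by the tree's linearised Weil datum `linWeil Unit Empty () (−1)`
  (`Paul1998.MetaplecticSplitting.fockVacuumCharacter_linearised`, from `JunctionVacuumOverlapPhase`); the vacuum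
  eigen-equation in closed form `ω (κ ((A,B),(C,·))) h₀ = (det B)⁻¹ • h₀` (`exists_vacuum_eigen_ι₁`); the COMPLETE exponent
  family `FockVacuumCharacter f ↔ f_P − f_Q = 1` (`fockVacuumCharacter_ι₁_iff_sub_eq_one`, now hypothesis-free) and the
  same for the printed-clauses form (`fockVacuumCharacterPrinted_ι₁_iff_sub_eq_one`); the Konno–Konno READING
  `kk07Reading m m′ ε 2 1 1 0` (parity `m` odd as printed, §4.1) is realised for `ε = −1` and NOT for `ε = +1`
  (`fockVacuumCharacter_ι₁_kk07Reading_neg_one`, `not_fockVacuumCharacter_ι₁_kk07Reading_one`) — the tree's sign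
  convention (`dualPairι` conjugates the same-sign blocks; module docstring §4 (b)–(c) of `FockModelUnitaryDualPair`).
* (c) **the degree-one `K`-types form a 2-dimensional space**: the holomorphic degree-one family
  `degOneP : (Fin 2 → ℂ) →ₗ[ℂ] 𝓢(ℝ³)` (`SchwartzDegreeOneKTypes`) is injective with `finrank ℂ (range degOneP) = 2`
  (`finrank_range_degOneP_ι₁`), and under the maximal compact `K_V × K_W = (U(2) × U(1)) × (U(1) × U(∅))` acting through
  ANY archimedean Weil datum over the junction it transforms by `det A^{e_P} det B^{e_Q} ⊗ std` — `U(2)` on `ℂ²`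
  (`apply_κ_degOneP_fst_ι₁` of `JunctionDegreeOneKTypes`, restated hypothesis-free for the linearised datum:
  `exists_degOne_KType_ι₁`, type `std ⊠ det⁻¹`).
* (d) **Paul's det-cover datum at `(2,1,1,0)` with every side condition discharged**: `[Nonempty (Fin 2 ⊕ Unit)]`,
  `[Nonempty (Unit ⊕ Empty)]` by instance search, the cover `pr : Mp₂(𝕎) ↠ Sp(𝕎)` with `ker pr = {1, ε}` from R1/R2 AS
  THEOREMS (`ArchMetaplecticDoubleCoverHolds`): the datum `Mp₂.coverDatum (Fin 2) Unit Unit Empty R1 R2` elaborates with no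
  binder left (`coverDatum_ι₁_fields`), and the record `DetCoverLifting` for it is PROVED (`detCoverLifting_ι₁` =
  `detCoverLifting_linearised_holds 0 ()`), with its topology-free corollary (`exists_isDetCoverLifting_ι₁`); block
  cardinalities `(2,1,1,0)` and det-cover exponents `(1,1)` by `simp` (`card_blocks_ι₁`, `detCover_exponents_ι₁`).

Sources (held; journal page = PDF page + 34 for KK07): T. Konno, K. Konno, *On doubling construction for real unitary
dual pairs*, Kyushu J. Math. 61 (2007) 35–82, Lemma 5.2 p. 73 [corpus: paper:doi-10-2206-kyushujm-61-35 p0039 L44–45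
«LEMMA 5.2. We have the following. (i) If d_ψ i < 0, the restriction of (ω_{V,W,ξ}, P_{V,W,ξ}) to K_V × K_W is given
by …»], §4.1 p. 49 (parities); A. Paul, *Howe correspondence for real unitary groups*, J. Funct. Anal. 159 (1998)
384–431, §1.2 (1.2.1) p. 389 [corpus: paper:doi-10-1006-jfan-1998-3330 p0006 L11–23 «Let S̃p be the unique nontrivial
two-fold cover of the symplectic group … There are two-fold covers Ũ(p, q) and Ũ(r, s) … and a lifting ι̃ : Ũ(p, q) ×
Ũ(r, s) → S̃p (1.2.1) of the map ι_J … Ũ(p, q) is isomorphic to the det^{(r−s)/2}-cover of U(p, q)»]; G. B. Folland,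
*Harmonic Analysis in Phase Space* (1989), §4.2 Thm. (4.37), Prop. (4.39).
-/

set_option autoImplicit false

noncomputable section

open MeasureTheory Complex SchwartzMap Matrix
open scoped InnerProductSpace ComplexConjugate Real

namespace Literature.RepresentationTheory.KonnoKonno2007

namespace RealDualPair

open Literature.Analysis.SegalBargmann Literature.RepresentationTheory.HeisenbergGroup
open Literature.NumberTheory.Weil1964 Literature.NumberTheory.Automorphic
open Literature.NumberTheory.Automorphic.UnitaryGroup

/-! ## §1. The junction instance `(U(2,1), U(1,0))` and its block cardinalities -/

/-- the block cardinalities of the `ι₁` currency are `(p,q,r,s) = (2,1,1,0)`. [cite: KonnoKonno2007, §3.1 p. 44 L5–13] -/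
theorem card_blocks_ι₁ :
    (Fintype.card (Fin 2), Fintype.card Unit, Fintype.card Unit, Fintype.card Empty) = (2, 1, 1, 0) := by
  simp

/-- the phase space `𝕎 = V ⊗_ℂ W` of the `ι₁` junction has `3 = (2·1 + 1·0) + (2·0 + 1·1)` complex coordinates
(`DPIdx (Fin 2) Unit Unit Empty`), i.e. `𝕎_ℝ = ℝ³ × ℝ³`. [cite: KonnoKonno2007, §3.1 p. 44 L5–13] -/
theorem card_DPIdx_ι₁ : Fintype.card (DPIdx (Fin 2) Unit Unit Empty) = 3 := by
  simp

/-- **THE JUNCTION OF RECORD `U(2,1) × U(1)` is inhabited with no hypothesis**: the real unitary dual pair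
`(U(V), U(W))`, `sgn V = (2,1)`, `sgn W = (1,0)`, in `Sp(𝕎)`, `𝕎 = V ⊗_ℂ W ≅ ℂ³`, with its maximal compact
`(U(2) × U(1)) × (U(1) × U(∅))`, is the tree's CONSTRUCTED `junction (Fin 2) Unit Unit Empty` (`RealUnitaryDualPair`), whose
dual-pair map is `ι𝕎 (Fin 2) Unit Unit Empty : U(2,1) × U(1,0) →* Sp(𝕎)` and whose compact inclusion is `κ`, with the
compatibility `ι𝕎 ∘ κ = realifySp ∘ dualPairι` a theorem. [cite: KonnoKonno2007, §3.1 (3.1) p. 44 L5–13] -/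
theorem junction_ι₁_spec :
    (junction (Fin 2) Unit Unit Empty).ι𝕎 = ι𝕎 (Fin 2) Unit Unit Empty ∧
      (junction (Fin 2) Unit Unit Empty).κ = κ (Fin 2) Unit Unit Empty ∧
      ∀ k : DPK (Fin 2) Unit Unit Empty,
        ι𝕎 (Fin 2) Unit Unit Empty (κ (Fin 2) Unit Unit Empty k) = realifySp (DPIdx (Fin 2) Unit Unit Empty) (dualPairι k) :=
  ⟨rfl, rfl, ι𝕎_κ⟩

/-! ## §2. The vacuum character, EVALUATED (Konno–Konno Lemma 5.2 at `U(2,1) × U(1)` as a theorem) -/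

/-- **[KonnoKonno2007, Lemma 5.2] HOLDS at `U(2,1) × U(1)`** with exponent tuple `(e_P, e_Q, e_R, e_S) = (0, −1, 0, 0)`:
there is an archimedean Weil datum over `ι𝕎` whose vacuum `h₀` is a `K_V × K_W`-eigenvector with character
`det(A)^0 det(B)^{−1} det(C)^0 det(D)^0` — realised by the tree's linearised datum (no hypothesis).
[cite: KonnoKonno2007, Lemma 5.2 (i)/(ii) p. 73 L44–102; Folland1989, §4.2 Prop. (4.39)] -/
theorem fockVacuumCharacter_ι₁ : (junction (Fin 2) Unit Unit Empty).FockVacuumCharacter ⟨0, -1, 0, 0⟩ := by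
  have h := Paul1998.MetaplecticSplitting.fockVacuumCharacter_linearised (P := Fin 2) (Q := Unit) Unit Empty
    (0 : Fin 2) ()
  simpa using h

/-- the vacuum scalar of `(0, −1, 0, 0)` at `k = ((A,B),(C,D)) ∈ (U(2) × U(1)) × (U(1) × U(∅))` is `(det B)⁻¹ = B⁻¹`.
[cite: KonnoKonno2007, Lemma 5.2 (i)/(ii) p. 73 L44–102] -/
theorem vacScalar_ι₁ (k : DPK (Fin 2) Unit Unit Empty) :
    vacScalar (⟨0, -1, 0, 0⟩ : VacExponents) k = ((k.1.2 : Matrix Unit Unit ℂ) () ())⁻¹ := by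
  simp [vacScalar, Matrix.det_unique]

/-- **the vacuum eigen-equation in closed form**: for some archimedean Weil datum `ω` over the junction,
`ω (κ ((A,B),(C,D))) h₀ = B⁻¹ • h₀` for all `((A,B),(C,D)) ∈ K_V × K_W`.
[cite: KonnoKonno2007, Lemma 5.2 (i)/(ii) p. 73 L44–102; Folland1989, §4.2 Prop. (4.39)] -/
theorem exists_vacuum_eigen_ι₁ :
    ∃ ω : Representation ℂ (Ginf (Fin 2) Unit Unit Empty) (SchwartzMap (DPIdx (Fin 2) Unit Unit Empty → ℝ) ℂ),
      IsArchWeilDatum (ι𝕎 (Fin 2) Unit Unit Empty) ω ∧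
      ∀ k : DPK (Fin 2) Unit Unit Empty,
        ω (κ (Fin 2) Unit Unit Empty k) (hermitePi 0) = (((k.1.2 : Matrix Unit Unit ℂ) () ())⁻¹) • hermitePi 0 := by
  obtain ⟨ω, hW, hvac⟩ := fockVacuumCharacter_ι₁
  exact ⟨ω, hW, fun k => by rw [← vacScalar_ι₁ k]; exact hvac k⟩

/-- **the complete exponent family at `U(2,1) × U(1)`, hypothesis-free**: `f` is a vacuum exponent tuple of SOME
archimedean Weil datum over the junction iff `f_P − f_Q = 1` (`= |R| − |S|`); the `U(W)`-exponents are free.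
[cite: KonnoKonno2007, Lemma 5.2 (i)/(ii) p. 73 L44–102, Thm 5.4 (i) (5.6)–(5.7) p. 75] -/
theorem fockVacuumCharacter_ι₁_iff_sub_eq_one (f : VacExponents) :
    (junction (Fin 2) Unit Unit Empty).FockVacuumCharacter f ↔ f.eP - f.eQ = 1 :=
  fockVacuumCharacter_ι₁_iff_of_realised fockVacuumCharacter_ι₁ f

/-- **the printed-clauses record at `U(2,1) × U(1)`, hypothesis-free**: `FockVacuumCharacterPrinted f ↔ f_P − f_Q = 1`.
[cite: KonnoKonno2007, Lemma 5.2 (i)/(ii) p. 73 L44–102; §2.1 p. 38 L5–11; §3.3 p. 47 L51–86] -/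
theorem fockVacuumCharacterPrinted_ι₁_iff_sub_eq_one (f : VacExponents) :
    (junction (Fin 2) Unit Unit Empty).FockVacuumCharacterPrinted f ↔ f.eP - f.eQ = 1 :=
  fockVacuumCharacter_ι₁_iff_printed.symm.trans (fockVacuumCharacter_ι₁_iff_sub_eq_one f)

/-- in particular the printed-clauses record holds at `(0, −1, 0, 0)`. [cite: KonnoKonno2007, Lemma 5.2 (i)/(ii) p. 73 L44–102] -/
theorem fockVacuumCharacterPrinted_ι₁ : (junction (Fin 2) Unit Unit Empty).FockVacuumCharacterPrinted ⟨0, -1, 0, 0⟩ :=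
  fockVacuumCharacter_ι₁.printed

/-- **the Konno–Konno READING is realised for `ε = −1`**: with the printed parity `m ≡ n′ = 1 (mod 2)` (§4.1), the tuple
`kk07Reading m m′ (−1) 2 1 1 0 = ((m+1)/2, (m−1)/2, (m′−1)/2, (m′+1)/2)` is a vacuum exponent tuple at `U(2,1) × U(1)`
(`ε = ε_ψ = −1` is the tree's `ψ_∞(x) = e^{−2πix}`, module docstring §4 (b) of `FockModelUnitaryDualPair`).
[cite: KonnoKonno2007, Lemma 5.2 (ii) p. 73 L102–149; §4.1 p. 49 L21–28] -/
theorem fockVacuumCharacter_ι₁_kk07Reading_neg_one (m m' : ℤ) (hm : Odd m) :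
    (junction (Fin 2) Unit Unit Empty).FockVacuumCharacter (kk07Reading m m' (-1) 2 1 1 0) := by
  rw [fockVacuumCharacter_ι₁_iff_sub_eq_one]
  have hm' : Even (m + (((1 : ℕ) : ℤ) + ((0 : ℕ) : ℤ))) := by
    simpa using hm.add_one
  have h := kk07Reading_eP_sub_eQ m m' (-1) 2 1 1 0 (Or.inr rfl) hm'
  rw [h]
  norm_num

/-- **… and NOT for `ε = +1`** (the `V`-side zero-point pin `e_P − e_Q = |R| − |S| = 1` forces the sign).
[cite: KonnoKonno2007, Lemma 5.2 (i) p. 73 L44–102; §4.1 p. 49 L21–28] -/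
theorem not_fockVacuumCharacter_ι₁_kk07Reading_one (m m' : ℤ) (hm : Odd m) :
    ¬ (junction (Fin 2) Unit Unit Empty).FockVacuumCharacter (kk07Reading m m' 1 2 1 1 0) := by
  rw [fockVacuumCharacter_ι₁_iff_sub_eq_one]
  have hm' : Even (m + (((1 : ℕ) : ℤ) + ((0 : ℕ) : ℤ))) := by
    simpa using hm.add_one
  have h := kk07Reading_eP_sub_eQ m m' 1 2 1 1 0 (Or.inl rfl) hm'
  rw [h]
  norm_num

/-! ## §3. The degree-one `K`-types: a 2-dimensional space, `U(2)` acting by `det^{e_P} ⊗ std` -/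

/-- **the degree-one `K`-types form a 2-dimensional space**: the holomorphic degree-one family
`degOneP : (Fin 2 → ℂ) →ₗ[ℂ] 𝓢(ℝ³)`, `a ↦ Σᵢ aᵢ h_{eᵢ}`, is injective, so its range — the `K_V × K_W`-module of
degree-one harmonics — has `ℂ`-dimension `2`. [cite: KonnoKonno2007, Thm 5.4 (i) (5.6) p. 75; Folland1989, §4.2 Prop. (4.39)] -/
theorem finrank_range_degOneP_ι₁ :
    Module.finrank ℂ (LinearMap.range
      (degOneP : (Fin 2 → ℂ) →ₗ[ℂ] SchwartzMap (DPIdx (Fin 2) Unit Unit Empty → ℝ) ℂ)) = 2 := by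
  rw [LinearMap.finrank_range_of_inj degOneP_injective, Module.finrank_fin_fun]

/-- **the degree-one `K`-type, hypothesis-free**: for the archimedean Weil datum of `fockVacuumCharacter_ι₁` the compact
group `K_V = U(2) × U(1)` acts on the 2-dimensional degree-one space by `(A, B) ↦ (det B)⁻¹ · A` — type `std ⊠ det⁻¹`
(`U(2)` on `ℂ²` by its standard representation; for a general realised tuple `e` the type is `det^{e_P} std ⊠ det^{e_Q}`,
`apply_κ_degOneP_fst_ι₁`). [cite: KonnoKonno2007, Thm 5.4 (i) (5.6) p. 75; Folland1989, §4.2 Prop. (4.39)] -/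
theorem exists_degOne_KType_ι₁ :
    ∃ ω : Representation ℂ (Ginf (Fin 2) Unit Unit Empty) (SchwartzMap (DPIdx (Fin 2) Unit Unit Empty → ℝ) ℂ),
      IsArchWeilDatum (ι𝕎 (Fin 2) Unit Unit Empty) ω ∧
      (∀ k : DPK (Fin 2) Unit Unit Empty,
        ω (κ (Fin 2) Unit Unit Empty k) (hermitePi 0) = vacScalar ⟨0, -1, 0, 0⟩ k • hermitePi 0) ∧
      ∀ (kV : Matrix.unitaryGroup (Fin 2) ℂ × Matrix.unitaryGroup Unit ℂ) (a : Fin 2 → ℂ),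
        ω (κ (Fin 2) Unit Unit Empty (kV, 1)) (degOneP a) =
          ((kV.2 : Matrix Unit Unit ℂ).det)⁻¹ • degOneP ((kV.1 : Matrix (Fin 2) (Fin 2) ℂ) *ᵥ a) := by
  obtain ⟨ω, hW, hvac⟩ := fockVacuumCharacter_ι₁
  refine ⟨ω, hW, hvac, fun kV a => ?_⟩
  rw [apply_κ_degOneP_fst_ι₁ ω hW.covariant hW.exists_lift hvac kV a]
  simp

end RealDualPair

end Literature.RepresentationTheory.KonnoKonno2007

/-! ## §4. Paul's det-cover datum at `(2,1,1,0)`: every side condition discharged, the record a theorem -/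

namespace Literature.RepresentationTheory.Paul1998

namespace MetaplecticSplitting

open Literature.Analysis.SegalBargmann Literature.RepresentationTheory.HeisenbergGroup
open Literature.NumberTheory.Weil1964 Literature.NumberTheory.Weil1964.MpS
open Literature.NumberTheory.Automorphic Literature.NumberTheory.Automorphic.UnitaryGroup
open Literature.RepresentationTheory.KonnoKonno2007 Literature.RepresentationTheory.KonnoKonno2007.RealDualPair

/-- the non-emptiness side conditions of `UnitaryDetCoverInstance.coverDatum` at `(2,1,1,0)`: `V ≠ 0` (`Fin 2 ⊕ Unit`
is inhabited) … [cite: Paul1998, §1.1 (1.1.2) p. 388 L62–64] -/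
theorem nonempty_blocksV_ι₁ : Nonempty (Fin 2 ⊕ Unit) := inferInstance

/-- … and `W ≠ 0` (`Unit ⊕ Empty` is inhabited). [cite: Paul1998, §1.1 (1.1.2) p. 388 L62–64] -/
theorem nonempty_blocksW_ι₁ : Nonempty (Unit ⊕ Empty) := inferInstance

/-- **[Paul1998, (1.2.1)–(1.2.2)] at `U(2,1) × U(1)` is a THEOREM, every side condition of the datum discharged**:
Paul's det-cover datum of `(U(2,1), U(1,0))` over the METAPLECTIC two-fold cover `pr : Mp₂(𝕎) ↠ Sp(𝕎)` is
`Mp₂.coverDatum (Fin 2) Unit Unit Empty R1 R2` with ALL arguments of `UnitaryDetCoverInstance.coverDatum` supplied by the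
tree — `[Nonempty (Fin 2 ⊕ Unit)]`, `[Nonempty (Unit ⊕ Empty)]` by instance search (`nonempty_blocksV_ι₁/W_ι₁`); `pr`
surjective, `pr ε = 1`, `ε ≠ 1`, `ker pr = {1, ε}` from [Folland1989, Thm. (4.37)] R1/R2 as THEOREMS
(`folland1989_Thm_4_37_ab_holds`, `folland1989_Thm_4_37_c_holds`) — and for it the record `DetCoverLifting` HOLDS: a
continuous det-cover lifting `ι̃ : Ũ(2,1)_{det^{1/2}} × Ũ(1)_{det^{1/2}} →* Mp₂(𝕎)` over `ι_J = ι𝕎`, an isomorphism of each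
factor onto the inverse image of the member (`detCoverLifting_linearised_holds`; no hypothesis).
[cite: Paul1998, §1.2 (1.2.1)–(1.2.2) p. 389 L11–31; Folland1989, §4.2 Thm. (4.37)] -/
theorem detCoverLifting_ι₁ :
    (Mp₂.coverDatum (Fin 2) Unit Unit Empty (folland1989_Thm_4_37_ab_holds (DPIdx (Fin 2) Unit Unit Empty))
      (folland1989_Thm_4_37_c_holds (DPIdx (Fin 2) Unit Unit Empty))).DetCoverLifting :=
  detCoverLifting_linearised_holds (R := Unit) (S := Empty) (0 : Fin 2) ()

/-- the datum's covering map is the metaplectic `pr : Mp₂(𝕎) → Sp(𝕎)` and its members embed by `ι_V = ι𝕎 (·, 1)`,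
`ι_W = ι𝕎 (1, ·)` (the «Sp», «GV × GW», «Mp» object-match duties of the record, all met by constructed objects).
[cite: Paul1998, §1.1 (1.1.2) p. 388 L62–64, §1.2 p. 389 L11–13] -/
theorem coverDatum_ι₁_fields :
    (Mp₂.coverDatum (Fin 2) Unit Unit Empty (folland1989_Thm_4_37_ab_holds (DPIdx (Fin 2) Unit Unit Empty))
        (folland1989_Thm_4_37_c_holds (DPIdx (Fin 2) Unit Unit Empty))).pr = Mp₂.pr ∧
      (Mp₂.coverDatum (Fin 2) Unit Unit Empty (folland1989_Thm_4_37_ab_holds (DPIdx (Fin 2) Unit Unit Empty))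
        (folland1989_Thm_4_37_c_holds (DPIdx (Fin 2) Unit Unit Empty))).ιV = UnitaryDualPairCover.ιV (Fin 2) Unit Unit Empty ∧
      (Mp₂.coverDatum (Fin 2) Unit Unit Empty (folland1989_Thm_4_37_ab_holds (DPIdx (Fin 2) Unit Unit Empty))
        (folland1989_Thm_4_37_c_holds (DPIdx (Fin 2) Unit Unit Empty))).ιW = UnitaryDualPairCover.ιW (Fin 2) Unit Unit Empty :=
  ⟨rfl, rfl, rfl⟩

/-- topology-free form: a det-cover lifting into `Mp₂(𝕎)` EXISTS at `U(2,1) × U(1)` (exponents `|R| − |S| = 1` on the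
`U(2,1)`-side, `|P| − |Q| = 1` on the `U(1)`-side). [cite: Paul1998, §1.2 (1.2.1) p. 389 L11–23] -/
theorem exists_isDetCoverLifting_ι₁ :
    ∃ L : detCover (unitaryGroupOfForm (starRingEnd ℂ) (signForm (Fin 2) Unit)) ((Fintype.card Unit : ℤ) - Fintype.card Empty) ×
        detCover (unitaryGroupOfForm (starRingEnd ℂ) (signForm Unit Empty)) ((Fintype.card (Fin 2) : ℤ) - Fintype.card Unit) →*
          Mp₂ (DPIdx (Fin 2) Unit Unit Empty),
      (Mp₂.coverDatum (Fin 2) Unit Unit Empty (folland1989_Thm_4_37_ab_holds (DPIdx (Fin 2) Unit Unit Empty))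
        (folland1989_Thm_4_37_c_holds (DPIdx (Fin 2) Unit Unit Empty))).IsDetCoverLifting L :=
  detCoverLifting_ι₁.exists_isDetCoverLifting

/-- the two det-cover exponents at `(2,1,1,0)` are `r − s = 1` and `p − q = 1` (both covers are the `det^{1/2}`-covers).
[cite: Paul1998, §1.2 p. 389 L19–25] -/
theorem detCover_exponents_ι₁ :
    ((Fintype.card Unit : ℤ) - Fintype.card Empty, (Fintype.card (Fin 2) : ℤ) - Fintype.card Unit) = (1, 1) := by
  simp

end MetaplecticSplitting

end Literature.RepresentationTheory.Paul1998

end
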